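import Summits.QuantumFields.YangMills.Theorems.BalabanUVNodesN15KingModelFullPropagatorMixedOperatorSupp
import Summits.QuantumFields.YangMills.Theorems.BalabanUVNodesN15KingModelFullPropagatorAdjGradHolderOperator
import Literature.MathematicalPhysics.QuantumFieldTheory.King1986.PropagatorDerivHolderSupNorm

/-!
# BalabanUVNodes ∕ N15 — THE KING-MODEL RUNG, CURVED EDITION (PACKAGE): [B9] THEOREM 3.1, THE SUP ∕ HÖLDER ENTRIES (3.43)₁, (3.43)₂, (3.44) AT `U ≡ 1`
# FOR KING'S FULL `A = 0` PROPAGATOR — ONE `(C, δ)` FOR ALL THREE, UNIFORMLY in `K`, the volume and the mass (one citable name for the node's consumers)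
# (Track A, DAG node N15 = NE2; FAN-OUT v1.1 §N15 s3 «KING-MODEL RUNG … + the one-line statement of what the curved case adds»)

HONEST FRAMING.  Count-neutral packaging (cell `pub-ymgap`, seat `pub-ymgap-dag-n15-e` g9; `--supports stmt-QuantumFields-20544 --as helper` = K3⁷
`SpineGivenEndpointR13SepCoPH`, WORDS-143).  TEMPLATE LITERATURE, `A = 0`: C. King's scalar U(1)-Higgs MODEL on finite tori ([King1986] (2.13) p. 653,
Theorem 3.3 (3.8) p. 656, (3.62) p. 663, Prop. 3.7 (3.63)∕(3.65) p. 663), NOT Bałaban's covariant objects.  [Balaban1985BackgroundPropagators] Thm 3.1 p. 398: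
(3.43) «`‖ζ∇_UGλ‖_β, ‖ζG∇*_Uλ‖_β ≤ B₀(β)(L^jη)^{1−β}…e^{−δ₀d(y,y′)}|λ|`», (3.44) «`|(∇_UG∇*_Uλ)(x)| ≤ B′₀(ε)e^{−δ₀d(y,y′)}(ξ′^ε‖λ‖_ε + |λ|)`».  This file RESTATES
NOTHING new in substance: §1 is the tree's `King1986.Torus.fineOp_inv_deriv_holder_decay_unif` (PART U-ii = [Ba 4] (1.9) in King's spelling) read for the
cubes `2L^e` and all pairs `x, x′`; §2 conjoins §1, part W-b `fullPropAdjOp_holder_le` and part V-c `fullPropMixedOp_holder_le_of_suppDist` under ONE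
pair of constants (max ∕ min).  Decided in the MODEL at `U ≡ 1`; NOT the printed proposition (covariant `G(U)` over `Reg335`, multiscale carrier); (3.45)
is NOT included (open at `U ≡ 1` in the tree); the `L²` entries (3.46)–(3.47) are part X `fullPropOps_l2_unif` (other shape, not re-bundled); NE2⁺ is NOT
PRINTED and not proved here; NOT a node discharge; nothing continuum ∕ ℝ⁴ ∕ OS ∕ mass-gap ∕ Clay.  0 `sorry`, 0 `def`, standard axioms.
* §1 `fullPropGradOp_holder_le` ((3.43)₁ in the format of parts W-b ∕ V-c);  §2 ★★ **`kingFullProp_B9Thm31_sup_holder_at_trivialU`**.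
WHAT THE CURVED CASE ADDS (one line): Theorem 3.1 itself — the same three entries for `G(U)` uniformly over `Reg335`, multiscale sites, (3.45), analyticity.
HONEST SCOPE.  (i) `A = 0`, periodic b.c., odd `L ≥ 3`, cubes `2L^e`, `K ≥ 1`, `0 < m² ≤ m₀²`; (ii) King's spelling of `A₀ = fineOp N M a_K N² m²`,
forward η-differences, sup torus distance, weights in unit coordinates of level `K`; (iii) block-distance currency `D ≥ 0` for the supports; (iv) `0 < α < 1`,
`0 < ε ≤ 1`; (v) not Bałaban's `G(U)`; not a discharge.
Locators: [Balaban1985BackgroundPropagators] Thm 3.1 (3.43)–(3.44) p. 398; [Balaban1983RegularityDecay] Theorem (1.9)–(1.10) p. 573; [King1986] (2.13) p. 653,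
Theorem 3.3 (3.8) p. 656, (3.62), Prop. 3.7 (3.63)∕(3.65) p. 663.
-/

noncomputable section

namespace Summit.QuantumFields.YangMills.BalabanUVNodes.N15KingModelRung.Curved

open Real Finset Matrix
open Literature.MathematicalPhysics.QuantumFieldTheory.Balaban1983to89 (Params)
open Literature.MathematicalPhysics.QuantumFieldTheory.Balaban1983to89.B5Prop11Plancherel (Tor fine unitVec)
open Literature.MathematicalPhysics.QuantumFieldTheory.King1986 (aK aK_pos)
open Literature.MathematicalPhysics.QuantumFieldTheory.King1986.Torus (fineOp constrainedProp blockOf tdistT tdistT_nonneg tdistT_symm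
  tdistT_self fineOp_inv_deriv_holder_decay_unif)

variable {d : ℕ} (L : ℕ) [NeZero L]

/-! ## §1 (3.43), first half, in the format of parts W-b ∕ V-c -/

omit [NeZero L] in
/-- **[B9] (3.43), FIRST HÖLDER NORM, AT `U ≡ 1`** (the tree's `fineOp_inv_deriv_holder_decay_unif` = [Ba 4] (1.9) in King's spelling, read for the
cubes `M_μ = 2L^e` and ALL pairs `x, x′`): for odd `L ≥ 3`, `a > 0`, `m₀² ≥ 0`, `0 < α < 1` there are `C, δ > 0` such that for every `K ≥ 1` (`N = L^K`),
cube `2L^e`, `0 < m² ≤ m₀²`, `μ`, every `λ` with `|λ| ≤ F`, all `x, x′` and every `D` with `D ≤ |B(x) − B(y)|, |B(x′) − B(y)|` on `supp λ`: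
`(|x − x′|∕N)^{−α}·|N((A₀⁻¹λ)(x′+e_μ) − (A₀⁻¹λ)(x′)) − N((A₀⁻¹λ)(x+e_μ) − (A₀⁻¹λ)(x))| ≤ C·e^{−δD}·F`.
[cite: Balaban1985BackgroundPropagators, Thm 3.1 (3.43) p.398; Balaban1983RegularityDecay, Theorem (1.9) p.573; King1986, Theorem 3.3 (3.8) p.656, (3.62) p.663] -/
theorem fullPropGradOp_holder_le (hLodd : Odd L) (hL : 2 ≤ L) {a : ℝ} (ha : 0 < a) {m0sq : ℝ} (hm0 : 0 ≤ m0sq)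
    {α : ℝ} (hα0 : 0 < α) (hα1 : α < 1) :
    ∃ C δ : ℝ, 0 < C ∧ 0 < δ ∧ ∀ (K : ℕ), 1 ≤ K → ∀ (N : ℕ) [NeZero N], N = L ^ K →
      ∀ (e : ℕ) (M : Fin (d + 1) → ℕ) [∀ μ, NeZero (M μ)], (∀ μ, M μ = 2 * L ^ e) →
      ∀ (msq : ℝ), 0 < msq → msq ≤ m0sq → ∀ (μ : Fin (d + 1)) (lam : Tor (fine N M) → ℝ) (F D : ℝ),
        (∀ y, |lam y| ≤ F) → ∀ x x' : Tor (fine N M),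
        (∀ y, lam y ≠ 0 → D ≤ tdistT M (blockOf N M x) (blockOf N M y)) →
        (∀ y, lam y ≠ 0 → D ≤ tdistT M (blockOf N M x') (blockOf N M y)) →
        (tdistT (fine N M) x x' / (N : ℝ)) ^ (-α) *
          |(N : ℝ) * (((fineOp N M (aK a L K) (((N : ℕ) : ℝ) ^ 2) msq)⁻¹ *ᵥ lam) (x' + unitVec (fine N M) μ)
              - ((fineOp N M (aK a L K) (((N : ℕ) : ℝ) ^ 2) msq)⁻¹ *ᵥ lam) x')
            - (N : ℝ) * (((fineOp N M (aK a L K) (((N : ℕ) : ℝ) ^ 2) msq)⁻¹ *ᵥ lam) (x + unitVec (fine N M) μ)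
              - ((fineOp N M (aK a L K) (((N : ℕ) : ℝ) ^ 2) msq)⁻¹ *ᵥ lam) x)|
          ≤ C * Real.exp (-(δ * D)) * F := by
  have hL1 : 1 < L := by omega
  obtain ⟨δ₀, c₀, hδ₀, hc₀, H⟩ :=
    fineOp_inv_deriv_holder_decay_unif (d + 1) L (by omega) ⟨hLodd, hL1⟩ ha hm0 hα0.le hα1
  refine ⟨c₀, δ₀, hc₀, hδ₀, ?_⟩
  intro K hK N _ hN e M _ hM msq hmsq hcap μ lam F D hF x x' hDx hDx'
  by_cases hxx : x' = x
  · subst hxx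
    rw [sub_self, abs_zero, mul_zero]
    have hF0 : 0 ≤ F := (abs_nonneg _).trans (hF x')
    positivity
  set P : Params := ⟨d + 1, L, e, K, by omega, ⟨hLodd, hL1⟩⟩ with hP
  have hMK : ∀ μ, M μ = P.sitesPerDir P.K := fun μ => by rw [hM μ]; simp [hP, Params.sitesPerDir]
  exact H P rfl rfl hK msq hmsq.le hcap M hMK N hN lam F D hF x x' hxx hDx hDx' μ

/-! ## §2 The package -/

/-- **[B9] THEOREM 3.1 AT `U ≡ 1` — THE SUP ∕ HÖLDER ENTRIES (3.43)₁, (3.43)₂, (3.44) FOR KING'S FULL `A = 0` FLUCTUATION PROPAGATOR, ONE `(C, δ)`.**  For odd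
`L ≥ 3`, `a > 0`, `m₀² ≥ 0`, `0 < α < 1` and `0 < ε ≤ 1` there are `C, δ > 0` such that for every `K ≥ 1` (`N = L^K`), cube `M_μ = 2L^e` and mass
`0 < m² ≤ m₀²`, with `A₀ = fineOp N M a_K N² m²`, `(∇*_νg)(y) = N(g(y − e_ν) − g(y))`, block distance `D ≥ 0` to the support:
(3.43)₁ `(|x−x′|∕N)^{−α}|N((A₀⁻¹λ)(x′+e_μ) − (A₀⁻¹λ)(x′)) − N((A₀⁻¹λ)(x+e_μ) − (A₀⁻¹λ)(x))| ≤ C e^{−δD}‖λ‖_∞`;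
(3.43)₂ `(|x−x′|∕N)^{−α}|(A₀⁻¹∇*_νλ)(x′) − (A₀⁻¹∇*_νλ)(x)| ≤ C e^{−δD}‖λ‖_∞`;
(3.44) `|N((A₀⁻¹∇*_μλ)(x+e_μ′) − (A₀⁻¹∇*_μλ)(x))| ≤ C·H·e^{−δD}` for `λ` with Hölder modulus `H` (`|λ(y) − λ(y′)| ≤ H(|y−y′|∕N)^ε`).
The `L²` entries (3.46)–(3.47) are part X `fullPropOps_l2_unif`; (3.45) is not claimed.
[cite: Balaban1985BackgroundPropagators, Thm 3.1 (3.43)–(3.44) p.398; Balaban1983RegularityDecay, Theorem (1.9)–(1.10) p.573; King1986, (2.13) p.653, Prop. 3.7 (3.63)/(3.65) p.663] -/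
theorem kingFullProp_B9Thm31_sup_holder_at_trivialU (hLodd : Odd L) (hL : 2 ≤ L) {a : ℝ} (ha : 0 < a) {m0sq : ℝ} (hm0 : 0 ≤ m0sq)
    {α : ℝ} (hα0 : 0 < α) (hα1 : α < 1) {ε : ℝ} (hε0 : 0 < ε) (hε1 : ε ≤ 1) :
    ∃ C δ : ℝ, 0 < C ∧ 0 < δ ∧ ∀ (K : ℕ), 1 ≤ K → ∀ (N : ℕ) [NeZero N], N = L ^ K →
      ∀ (e : ℕ) (M : Fin (d + 1) → ℕ) [∀ μ, NeZero (M μ)], (∀ μ, M μ = 2 * L ^ e) →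
      ∀ (msq : ℝ), 0 < msq → msq ≤ m0sq →
        (∀ (μ : Fin (d + 1)) (lam : Tor (fine N M) → ℝ) (F D : ℝ), 0 ≤ D → (∀ y, |lam y| ≤ F) → ∀ x x' : Tor (fine N M),
          (∀ y, lam y ≠ 0 → D ≤ tdistT M (blockOf N M x) (blockOf N M y)) →
          (∀ y, lam y ≠ 0 → D ≤ tdistT M (blockOf N M x') (blockOf N M y)) →
          (tdistT (fine N M) x x' / (N : ℝ)) ^ (-α) *
            |(N : ℝ) * (((fineOp N M (aK a L K) (((N : ℕ) : ℝ) ^ 2) msq)⁻¹ *ᵥ lam) (x' + unitVec (fine N M) μ)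
                - ((fineOp N M (aK a L K) (((N : ℕ) : ℝ) ^ 2) msq)⁻¹ *ᵥ lam) x')
              - (N : ℝ) * (((fineOp N M (aK a L K) (((N : ℕ) : ℝ) ^ 2) msq)⁻¹ *ᵥ lam) (x + unitVec (fine N M) μ)
                - ((fineOp N M (aK a L K) (((N : ℕ) : ℝ) ^ 2) msq)⁻¹ *ᵥ lam) x)|
            ≤ C * Real.exp (-(δ * D)) * F) ∧
        (∀ (ν : Fin (d + 1)) (lam : Tor (fine N M) → ℝ) (F D : ℝ), 0 ≤ D → (∀ y, |lam y| ≤ F) → ∀ x x' : Tor (fine N M),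
          (∀ y, lam y ≠ 0 → D ≤ tdistT M (blockOf N M x) (blockOf N M y)) →
          (∀ y, lam y ≠ 0 → D ≤ tdistT M (blockOf N M x') (blockOf N M y)) →
          (tdistT (fine N M) x x' / (N : ℝ)) ^ (-α) *
            |((fineOp N M (aK a L K) (((N : ℕ) : ℝ) ^ 2) msq)⁻¹ *ᵥ (fun y => (N : ℝ) * (lam (y - unitVec (fine N M) ν) - lam y))) x'
              - ((fineOp N M (aK a L K) (((N : ℕ) : ℝ) ^ 2) msq)⁻¹ *ᵥ (fun y => (N : ℝ) * (lam (y - unitVec (fine N M) ν) - lam y))) x|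
            ≤ C * Real.exp (-(δ * D)) * F) ∧
        (∀ (μ μ' : Fin (d + 1)) (lam : Tor (fine N M) → ℝ) (H D : ℝ), 0 ≤ H → 0 ≤ D →
          (∀ y y', |lam y - lam y'| ≤ H * (tdistT (fine N M) y y' / (N : ℝ)) ^ ε) → ∀ x : Tor (fine N M),
          (∀ y, lam y ≠ 0 → D ≤ tdistT M (blockOf N M x) (blockOf N M y)) →
          |(N : ℝ) * (((fineOp N M (aK a L K) (((N : ℕ) : ℝ) ^ 2) msq)⁻¹
                  *ᵥ (fun y => (N : ℝ) * (lam (y - unitVec (fine N M) μ) - lam y))) (x + unitVec (fine N M) μ')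
              - ((fineOp N M (aK a L K) (((N : ℕ) : ℝ) ^ 2) msq)⁻¹
                  *ᵥ (fun y => (N : ℝ) * (lam (y - unitVec (fine N M) μ) - lam y))) x)|
            ≤ C * H * Real.exp (-(δ * D))) := by
  obtain ⟨C₁, δ₁, hC₁, hδ₁, H₁⟩ := fullPropGradOp_holder_le (d := d) L hLodd hL ha hm0 hα0 hα1
  obtain ⟨C₂, δ₂, hC₂, hδ₂, H₂⟩ := fullPropAdjOp_holder_le (d := d) L hLodd hL ha hm0 hα0 hα1
  obtain ⟨C₃, δ₃, hC₃, hδ₃, H₃⟩ := fullPropMixedOp_holder_le_of_suppDist (d := d) L hLodd hL ha hm0 hε0 hε1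
  set C : ℝ := max C₁ (max C₂ C₃) with hCdef
  set δ : ℝ := min δ₁ (min δ₂ δ₃) with hδdef
  have hC1 : C₁ ≤ C := le_max_left _ _
  have hC2 : C₂ ≤ C := (le_max_left _ _).trans (le_max_right _ _)
  have hC3 : C₃ ≤ C := (le_max_right _ _).trans (le_max_right _ _)
  have hd1 : δ ≤ δ₁ := min_le_left _ _
  have hd2 : δ ≤ δ₂ := (min_le_right _ _).trans (min_le_left _ _)
  have hd3 : δ ≤ δ₃ := (min_le_right _ _).trans (min_le_right _ _)
  have hδ : 0 < δ := lt_min hδ₁ (lt_min hδ₂ hδ₃)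
  -- monotonicity of the bound in `(C, δ)` for `D ≥ 0`
  have hmono : ∀ {Ci δi D X : ℝ}, Ci ≤ C → δ ≤ δi → 0 ≤ D → 0 ≤ X →
      Ci * Real.exp (-(δi * D)) * X ≤ C * Real.exp (-(δ * D)) * X := by
    intro Ci δi D X hCi hδi hD hX
    have h1 : Real.exp (-(δi * D)) ≤ Real.exp (-(δ * D)) :=
      Real.exp_le_exp.mpr (neg_le_neg (mul_le_mul_of_nonneg_right hδi hD))
    have hC0 : 0 ≤ C := hC₁.le.trans hC1
    exact mul_le_mul (mul_le_mul hCi h1 (Real.exp_pos _).le hC0) le_rfl hX (by positivity)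
  refine ⟨C, δ, lt_of_lt_of_le hC₁ hC1, hδ, ?_⟩
  intro K hK N _ hN e M _ hM msq hmsq hcap
  refine ⟨?_, ?_, ?_⟩
  · intro μ lam F D hD hF x x' hDx hDx'
    have hF0 : 0 ≤ F := (abs_nonneg _).trans (hF x)
    exact (H₁ K hK N hN e M hM msq hmsq hcap μ lam F D hF x x' hDx hDx').trans (hmono hC1 hd1 hD hF0)
  · intro ν lam F D hD hF x x' hDx hDx'
    have hF0 : 0 ≤ F := (abs_nonneg _).trans (hF x)
    exact (H₂ K hK N hN e M hM msq hmsq hcap ν lam F D hF x x' hDx hDx').trans (hmono hC2 hd2 hD hF0)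
  · intro μ μ' lam Hh D hH0 hD hH x hDx
    have h := H₃ K hK N hN e M hM msq hmsq hcap μ μ' lam Hh hH0 hH x D hDx
    have h' : C₃ * Hh * Real.exp (-(δ₃ * D)) ≤ C * Hh * Real.exp (-(δ * D)) := by
      have := hmono (X := Hh) hC3 hd3 hD hH0
      linarith [this]
    exact h.trans h'

end Summit.QuantumFields.YangMills.BalabanUVNodes.N15KingModelRung.Curved
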